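import Summits.AtomisticToContinuum.Crystallization.Theses.IsometryAtoms

/-!
# Negative knowledge for crux `MinimisingLawsHaveAtoms` (stmt-AtomisticToContinuum-15776), VI:
# the Mecke identity is covariant under linear automorphisms of `ℝ³` (scalings, rotations)

Standing crux disprover `cdisprove-stmt-AtomisticToContinuum-15776`,
`--supports stmt-AtomisticToContinuum-15776`; first piece of the THRESHOLD-SHARPNESS programme
(random scaling of the abstract minimising law), and a frame fact in its own right.

* `IsPointStationaryLaw.map_mapAddEquiv` — if `P` is point-stationary and `T : ℝ³ ≃+ ℝ³` is a
  bimeasurable additive automorphism, the law of `T_* μ` under `P` (the push-forward of `P` along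
  `μ ↦ μ.map T`) is point-stationary: both sides of the Mecke identity for `g` against the new law
  are the two sides for `g' μ x := g (μ.map T) (T x)` against `P`, because
  `θ_{T x} (T_* μ) = T_* (θ_x μ)` (`T (z − x) = T z − T x`).  No measurability of the inner integrals
  is needed (`lintegral_map_equiv` on `Measure ℝ³` and on `ℝ³`).
* `IsPointStationaryLaw.map_mapSmul` — in particular under every SCALING `μ ↦ (c • ·)_* μ`,
  `c ≠ 0`, and `IsPointStationaryLaw.map_mapLinearIsometryEquiv` — under every linear isometry.
* `isRootedHardCore_map_smul` — scaling by `c ≥ 1` keeps a rooted `δ`-hard-core configuration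
  rooted `δ`-hard-core.
Moral for the prover (and the disprover's next step): the frame of the crux MINUS the energy is
invariant under the one-parameter group of dilations; the energy `E_P[h]` is the only quantity
that moves, and it moves continuously — so (threshold sharpness, to come) dilating the abstract
minimising law by a random factor `λ ∈ [1, 1+η]` gives isometry-diffuse laws of energy
`e* + O(η)`: any proof must use the exact value `e*`.  All `[folklore]`.
-/

noncomputable section

namespace Summit.AtomisticToContinuum.Crystallization.Theorems.MinimisingLawsHaveAtoms.Negative.MeckeCovariance

open MeasureTheory Set Function
open scoped ENNReal
open Literature.MathematicalPhysics.StatisticalMechanics Literature.Probability.Process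

/-! ## §1 Push-forward of configurations along a bimeasurable additive automorphism -/

/-- `μ ↦ μ.map T` is measurable on `Measure ℝ³` for measurable `T`. [folklore] -/
theorem measurable_map_of_measurable {T : EuclideanSpace ℝ (Fin 3) → EuclideanSpace ℝ (Fin 3)}
    (hT : Measurable T) :
    Measurable fun μ : Measure (EuclideanSpace ℝ (Fin 3)) => μ.map T := by
  refine Measure.measurable_of_measurable_coe _ fun s hs => ?_
  simp only [Measure.map_apply hT hs]
  exact Measure.measurable_coe (hT hs)

/-- Shifting then transporting equals transporting then shifting by the transported vector:
`(θ_x μ).map T = θ_{T x} (μ.map T)` for an additive bimeasurable `T`. [folklore] -/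
theorem map_map_sub_addEquiv (T : EuclideanSpace ℝ (Fin 3) ≃+ EuclideanSpace ℝ (Fin 3))
    (hT : Measurable T) (μ : Measure (EuclideanSpace ℝ (Fin 3))) (x : EuclideanSpace ℝ (Fin 3)) :
    (μ.map fun z => z - x).map T = (μ.map T).map fun z => z - T x := by
  rw [Measure.map_map hT (measurable_sub_const x), Measure.map_map (measurable_sub_const (T x)) hT]
  congr 1
  funext z
  simp only [comp_apply, map_sub]

/-- **The Mecke identity is covariant under bimeasurable additive automorphisms of `ℝ³`.** If `P`
is point-stationary then so is its push-forward along `μ ↦ μ.map T` (`T : ℝ³ ≃+ ℝ³` with `T`,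
`T⁻¹` measurable). [folklore] -/
theorem _root_.Literature.Probability.Process.IsPointStationaryLaw.map_mapAddEquiv
    {P : Measure (Measure (EuclideanSpace ℝ (Fin 3)))} (hP : IsPointStationaryLaw P)
    (T : EuclideanSpace ℝ (Fin 3) ≃+ EuclideanSpace ℝ (Fin 3)) (hT : Measurable T)
    (hTs : Measurable T.symm) :
    IsPointStationaryLaw (P.map fun μ : Measure (EuclideanSpace ℝ (Fin 3)) => μ.map T) := by
  -- the transport as a measurable automorphism of configurations and of points
  set eT : EuclideanSpace ℝ (Fin 3) ≃ᵐ EuclideanSpace ℝ (Fin 3) :=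
    { toEquiv := T.toEquiv, measurable_toFun := hT, measurable_invFun := hTs } with heT
  have heTapp : ∀ x, eT x = T x := fun _ => rfl
  have hmapT : ∀ μ : Measure (EuclideanSpace ℝ (Fin 3)), μ.map T = μ.map eT := fun _ => rfl
  set E : Measure (EuclideanSpace ℝ (Fin 3)) ≃ᵐ Measure (EuclideanSpace ℝ (Fin 3)) :=
    { toFun := fun μ => μ.map T
      invFun := fun μ => μ.map T.symm
      left_inv := fun μ => by
        change (μ.map T).map T.symm = μ
        rw [Measure.map_map hTs hT]
        have : (T.symm : _ → _) ∘ (T : _ → _) = id := funext fun z => T.symm_apply_apply z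
        rw [this, Measure.map_id]
      right_inv := fun μ => by
        change (μ.map T.symm).map T = μ
        rw [Measure.map_map hT hTs]
        have : (T : _ → _) ∘ (T.symm : _ → _) = id := funext fun z => T.apply_symm_apply z
        rw [this, Measure.map_id]
      measurable_toFun := measurable_map_of_measurable hT
      measurable_invFun := measurable_map_of_measurable hTs } with hE
  have hEapp : (fun μ : Measure (EuclideanSpace ℝ (Fin 3)) => μ.map T) = E := rfl
  rw [hEapp]
  intro g hg
  rw [lintegral_map_equiv, lintegral_map_equiv]
  change ∫⁻ μ, ∫⁻ y, g (μ.map T) y ∂(μ.map T) ∂P =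
    ∫⁻ μ, ∫⁻ y, g ((μ.map T).map fun z => z - y) (-y) ∂(μ.map T) ∂P
  simp_rw [hmapT, lintegral_map_equiv, ← hmapT, heTapp]
  -- the transported test function
  set g' : Measure (EuclideanSpace ℝ (Fin 3)) → EuclideanSpace ℝ (Fin 3) → ℝ≥0∞ :=
    fun μ x => g (μ.map T) (T x) with hg'
  have hg'm : Measurable (uncurry g') :=
    hg.comp ((measurable_map_of_measurable hT).prodMap hT)
  have key := hP g' hg'm
  simp only [hg'] at key
  rw [key]
  refine lintegral_congr fun μ => lintegral_congr fun x => ?_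
  rw [map_map_sub_addEquiv T hT μ x, map_neg]

/-! ## §2 Scalings and linear isometries -/

/-- **The Mecke identity is covariant under scalings** `μ ↦ (c • ·)_* μ`, `c ≠ 0`. [folklore] -/
theorem _root_.Literature.Probability.Process.IsPointStationaryLaw.map_mapSmul
    {P : Measure (Measure (EuclideanSpace ℝ (Fin 3)))} (hP : IsPointStationaryLaw P) {c : ℝ}
    (hc : c ≠ 0) :
    IsPointStationaryLaw (P.map fun μ : Measure (EuclideanSpace ℝ (Fin 3)) =>
      μ.map fun x : EuclideanSpace ℝ (Fin 3) => c • x) := by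
  have h := hP.map_mapAddEquiv
    { toFun := fun x => c • x
      invFun := fun x => c⁻¹ • x
      left_inv := fun x => by simp [smul_smul, inv_mul_cancel₀ hc]
      right_inv := fun x => by simp [smul_smul, mul_inv_cancel₀ hc]
      map_add' := fun x y => smul_add c x y }
    (measurable_const_smul c) (measurable_const_smul c⁻¹)
  exact h

/-- **The Mecke identity is covariant under linear isometries** of `ℝ³`. [folklore] -/
theorem _root_.Literature.Probability.Process.IsPointStationaryLaw.map_mapLinearIsometryEquiv
    {P : Measure (Measure (EuclideanSpace ℝ (Fin 3)))} (hP : IsPointStationaryLaw P)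
    (A : EuclideanSpace ℝ (Fin 3) ≃ₗᵢ[ℝ] EuclideanSpace ℝ (Fin 3)) :
    IsPointStationaryLaw (P.map fun μ : Measure (EuclideanSpace ℝ (Fin 3)) =>
      μ.map fun x : EuclideanSpace ℝ (Fin 3) => A x) :=
  hP.map_mapAddEquiv A.toLinearEquiv.toAddEquiv A.continuous.measurable A.symm.continuous.measurable

/-- **Dilations keep the hard core**: for `1 ≤ c`, the dilate `(c • ·)_* μ` of a rooted `δ`-hard-core
configuration is rooted `δ`-hard-core (its carrier is `c • S`, `cδ`-separated). [folklore] -/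
theorem isRootedHardCore_map_smul {δ : ℝ} {μ : Measure (EuclideanSpace ℝ (Fin 3))}
    (h : IsRootedHardCore δ μ) {c : ℝ} (hc : 1 ≤ c) :
    IsRootedHardCore δ (μ.map fun x : EuclideanSpace ℝ (Fin 3) => c • x) := by
  obtain ⟨S, h0, hsep, rfl⟩ := h
  have hc0 : c ≠ 0 := by positivity
  have hinj : Injective fun x : EuclideanSpace ℝ (Fin 3) => c • x := smul_right_injective _ hc0
  refine ⟨(fun x => c • x) '' S, ⟨0, h0, smul_zero c⟩, ?_, ?_⟩
  · rintro _ ⟨x, hx, rfl⟩ _ ⟨y, hy, rfl⟩ hne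
    have hxy : x ≠ y := fun e => hne (by rw [e])
    rw [dist_smul₀, Real.norm_of_nonneg (by positivity)]
    calc δ ≤ dist x y := hsep x hx y hy hxy
      _ = 1 * dist x y := (one_mul _).symm
      _ ≤ c * dist x y := mul_le_mul_of_nonneg_right hc dist_nonneg
  · ext s hs
    rw [Measure.map_apply (measurable_const_smul c) hs, Measure.restrict_apply hs,
      Measure.restrict_apply ((measurable_const_smul c) hs),
      ← Set.image_preimage_inter (fun x => c • x) S s, Measure.count_injective_image hinj]

end Summit.AtomisticToContinuum.Crystallization.Theorems.MinimisingLawsHaveAtoms.Negative.MeckeCovariance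

end
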